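import Literature.MathematicalPhysics.QuantumFieldTheory.Balaban1983to89.B11Thm1ExistsUniqueRealisedDataBBridges
import Literature.MathematicalPhysics.QuantumFieldTheory.Balaban1983to89.B15Eq177GaugeInvariance
import Summits.QuantumFields.YangMills.Theorems.BalabanUVNodesN07RecordDomainsCollar
import HarnessLib

/-!
# DAG node N12 [B15] — THE LIFT TOKEN ([15] (11)–(13)) AND PRINT's INDUCTION AT REGULAR-REALISED DATA, AT PRINT's [II] (2.3) DATUM: for every family `F`, every guard implying the
# standing range and stable under truncation, `(E∕U)ᴮ[lamDatum F, dataRegularRealisedTopOf F N] ⟸ STEPᴮ ∧ (R)ᴮ` — the SUPPLY-at-1 and LIFT inputs of dag-n12-c g34's induction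
# `…TokensGBBridges.variationalThm1EUSepCoP7MGB_of_step_of_reg_of_base_of_lift` DISCHARGED (Literature `B11Thm1ExistsUniqueRealisedDataB{,Bridges}`, this seat)

Cell `pub-ymgap` (HUMAN RULINGS D-0062 ∕ D-0149), lane `pub-ymgap-dag-n12-c` g38 (R134 seat (a), N12 = [B15], s1, lane owner).  `--kind proof --supports stmt-QuantumFields-27364 --as helper`
(K1⁹; count-neutral).  THEOREMS ONLY (0 `def`, 0 `instance`, 0 `sorry`).  GREEN imports only (no `Record13*`; the index geometry of `Averaging.local_dep` is re-homed privately from the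
lane's ✓p759453 §2, whose module sits in the seam cone).

WHY.  N12's junction of record at print's datum (dag-n12-d g33 INTENT-168, v14ᴸᴮ) displays the (E∕U) name `B11Thm1ExistsUniqueTokensGB.VariationalThm1EUSepCoP7MGB F 2 Adm (lamDatum F) …`
as a HYPOTHESIS with no producer (orphan edge N07 → N12), and applies it at ONE datum: `W := avgFamily (avOfRecord F 2 Kt) (qsstarGIter0 (k i) (ext i Vk))` — a REALISED datum (`W (n+1) =
M(W n)` by construction) every level of which is plaquette-small inside `Z` (`B15Prop1DatumSmall7AtZSequence`).  Print's producer shape is NAME ⇐ STEP ∧ (R) ∧ SUPPLY-at-1 ∧ LIFT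
(`…TokensGBBridges`); the lane's s1 walk of [15] p. 279 (11) LOCATED that for a GENERAL datum with (7) the SUPPLY-at-1 ∕ LIFT tokens hide a lattice gauge-field EXTENSION lemma (print's
example filling «V₀,b = V_{b′} …, = 1» leaves the interface plaquettes uncontrolled), whereas for REGULAR-REALISED data (`B11Thm1ExistsUniqueRealisedDataB.DataRegularRealisedTop`: realised
below the top + full per-level plaquette smallness + the fine member small on the plaquettes meeting `Ω₁`) both are IDENTITIES: `V₀ := W` ((11): «V̄₀ = M(W_{k−1}) = W_k»), `U₀ := W 0`
((14) at `k = 1`).  The SUPPLY-at-1 token there is the Literature sibling's `approxMinimiserExistsCoP7MGB_lengthOne_realised`; THIS FILE proves the LIFT token there (it reads the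
Summits-side geometry: the `k`-bonds Bałaban's average reads at a constrained `(k+1)`-bond have their centres in `Ω_k`) and runs the induction: at regular-realised data the (E∕U)ᴮ name
follows from the ONE-LENGTH STEP token ([15] Prop. 2 + Sects. B–E given `U₀` with (14) — N07's) and K0's (R)ᴮ name (INHABITED at print's datum and K0⁷'s grid guard, dag-n12-d
✓`…Thm1NamesBInhabitedAtGridGuardLam` §1) ALONE.  Sequel (this seat): `…N12Thm1EUNameBOfStepAtRealisedDataLam` = the grid-guard composition with the inhabited (R)ᴮ.

WHAT.
* §0 private numerics (`η_j > 0`, `η_j = L·η_{j+1}`); §1 PRIVATE RE-HOME of the lane's index geometry `embIter_mem_of_blockOf_eq_endpoint` (✓p759453 §2; verbatim, `private`, so that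
  this file's closure stays outside the seam cone).
* §2 ★★ `variationalThm1EULiftTop7MGB_body_of_realised`: the LIFT token's BODY at `bd := lamDatum F`, `Dat := dataRegularRealisedTopOf F N`, every separated index `s` of length `k+1`
  (`0 < k`, `k+1 ≤ m+K`, `1 ≤ ν.M₁`), any selector read through `Ω_1`, thresholds in range, `0 ≤ B₃`, `2L³ ≤ C₁`: witnesses `(ε₀, δ, W)`; the truncated problem's data row by heredity
  (`DataRegularRealisedTop.truncSeq`); for every (8)-regular minimiser `U` of the truncated problem, (14) at length `k+1`: the class ranges at the scales `≤ k` coincide, the top ranges sit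
  inside the scale-`k` ones (factors `2L²` ∕ `2L³`), agreement BELOW the top by `Λ_j ⊆ Λ′_j` (✓p767704), AT the top by `Averaging.local_dep` + §1 + (R) `W (k+1) = M(W k)`.
* §3 ★★ `variationalThm1EULiftCoP7MGB_realised` (+ `…Top7MGB_realised` for any selector invariant under truncation): the LIFT TOKEN over `(lamDatum F, dataRegularRealisedTopOf F N)` for
  every guard `Adm` implying the standing range `k ≤ m + K`.
* §4 ★★★ `variationalThm1EUSepCoP7MGB_realised_of_step_of_reg`: for every guard implying the standing range and stable under truncation, `0 ≤ B₃`, `2L³ ≤ C₁`, `8L³ < C₁B₃`: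
  STEPᴮ[Dat^R] → (R)ᴮ[Dat^R] → (E∕U)ᴮ[Dat^R] at `lamDatum F`; corollaries `…_of_step_of_reg_lamTop ∕ _pTop` taking STEPᴮ and (R)ᴮ at the landed data predicates
  `dataSmall7LamTopOf` ∕ `dataSmall7PTopOf` (WEAKER data hypotheses ⇒ they serve regular-realised data, `.of_imp_dat`).

HONEST FRAMING.  Bookkeeping + one induction BY NAME over landed kernel theorems; the ONE-LENGTH STEP token ([15] Prop. 2 + Sects. B–E) stays a HYPOTHESIS (no producer — N07); K0's (R)ᴮ
name enters as a hypothesis here (inhabited elsewhere); nothing of Bałaban's estimates asserted or refuted; NOT a discharge; N12 NOT discharged; K0⁷ ∕ K1⁹ OPEN; counts unmoved (discharged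
8∕27); one finite 𝕋⁴ programme at fixed `ε = L^{-K}` — R4 closes only the conditional rung `BalabanLadder.UV`; nothing continuum ∕ ℝ⁴ ∕ OS; the Yang–Mills mass gap (Clay) is NOT proved.

[15] = [Balaban1985Variational] Thm 1 p.279, (2)–(7) p.278, (11) p.279, (12)–(14) p.280, Prop. 2 p.281; [Balaban1984PropagatorsII] (2.3) p.224; [Balaban1988Convergent] (2.1)–(2.2) pp.254–255,
(2.10)–(2.12) p.256, (2.18) p.257; [Balaban1985RegularSpaces] (1.3)–(1.9) p.77; [Balaban1987RG1] (0.1) p.251, (0.4) p.253.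
-/

noncomputable section

open scoped Matrix.Norms.L2Operator
namespace Summit.QuantumFields.YangMills.BalabanUVNodes.N12EUStepTokensAtRealisedDataLam

open Set
open Literature.MathematicalPhysics.QuantumFieldTheory.Balaban1983to89
open Literature.MathematicalPhysics.QuantumFieldTheory.Balaban1983to89.Node00
open B15DeterminingSets (DetSet pts mem_pts bondsOf embIter genSet AgreeOn avgFamily MSField)
open B15DeterminingSetsB (BDetSet AgreeOnB IsMinimizerB lamBondsSeq)
open B14.Eq213MaximalDomains (side)
open B5Eq118OneStroke (iterBlockOf)
open B5Prop12FieldsLattice (distSite distSite_self)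
open B5RowSumsP12Lattice (distSite_comm)
open B5Eq117TorusCarriers (Mk)
open T4Continuum (T4Family)
open B11Thm1ExistsUniqueTokensGB (ApproxMinTopB VariationalThm1EUSepCoP7MGB VariationalThm1EUStepCoP7MGB VariationalThm1EULiftTop7MGB VariationalThm1EULiftCoP7MGB
  variationalThm1EUSepCoP7MGB_of_step_of_reg_of_base_of_lift)
open B11Thm1ExistsUniqueInductionG (truncSeq truncSeq_Ω_of_le lamBondsSeq_truncSeq_top lamBondsSeq_succ_top agreeOnB_lamBondsSeq_below_of_truncSeq
  omegaPlaqsTop_truncSeq_of_le omegaBondsTop_truncSeq_of_le omegaPlaqsTop_succ_subset_truncSeq omegaBondsTop_succ_subset_truncSeq suppDomOfRecord_truncSeq)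
open B11Thm1ExistsUniqueRealisedDataB (DataRegularRealisedTop dataRegularRealisedTopOf approxMinimiserExistsCoP7MGB_lengthOne_realised
  dataSmall7PTopOf_of_dataRegularRealisedTopOf dataSmall7LamTopOf_of_dataRegularRealisedTopOf)
open Summit.QuantumFields.YangMills.BalabanUVNodes.N07RecordDomainsCollar (mem_enlT_of_distSite_iterBlockOf_le_one)
open Summit.QuantumFields.YangMills.Theorems.FlatCubeQContraction (distSite_shift_le_one)
open B15Eq177GaugeInvariance (blockIter_embIter)

/-! ## §0  Numerics of the lattices of record -/

section Numerics

variable (P : Params)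

/-- `0 < η_j`. [cite: Balaban1987RG1, (1.1) p.260 (bookkeeping)] -/
private theorem eta_pos (j : ℕ) : 0 < P.eta j := pow_pos (inv_pos.mpr (Nat.cast_pos.mpr P.L_pos)) j

/-- `η_j = L · η_{j+1}`. [cite: Balaban1987RG1, (1.1) p.260 (bookkeeping)] -/
private theorem eta_eq_L_mul_eta_succ (j : ℕ) : P.eta j = (P.L : ℝ) * P.eta (j + 1) := by
  have hL : (P.L : ℝ) ≠ 0 := Nat.cast_ne_zero.mpr P.L_pos.ne'
  unfold Params.eta
  rw [pow_succ, mul_comm ((P.L : ℝ)⁻¹ ^ j), ← mul_assoc, mul_inv_cancel₀ hL, one_mul]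

end Numerics

/-! ## §1  Index geometry (private re-home): the `k`-bonds read at a constrained `(k+1)`-bond have their centres in `Ω_k` -/

section Geometry

variable {P : Params}

/-- The two iterated block maps of the tree agree (private re-home of `N12FlatHndRecordLetters.blockIter_eq_iterBlockOf`, whose module is outside this file's green closure). [cite: Balaban1987RG1, (0.1) p.251 (bookkeeping)] -/
private theorem blockIter_eq_iterBlockOf' : ∀ (j : ℕ) (x : Site P 0), B14.Eq22Determines.blockIter j x = iterBlockOf j x
  | 0, _ => rfl
  | j + 1, x => by
    rw [B14.Eq22Determines.blockIter_succ, B5Eq118OneStroke.iterBlockOf_succ, blockIter_eq_iterBlockOf' j x]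

/-- PRIVATE RE-HOME of the lane's `N12EUStepTokensAtFlatDatum.embIter_mem_of_blockOf_eq_endpoint` (✓p759453 §2; statement and proof verbatim; its module imports the seam-cone (b)-road):
if one layer of `L^{k+1}M₁`-cubes around `Ω_{k+1}` lies inside `Ω_k` and a `(k+1)`-bond `c` MEETS `Ω_{k+1}^{(k+1)}`, then every `k`-site whose block is an end-point of `c` has its centre in
`Ω_k`. [cite: Balaban1985RegularSpaces, (1.3)–(1.6) p.77; Balaban1987RG1, (0.1)–(0.4) pp.251–253; Balaban1988Convergent, (2.1) p.254] -/
private theorem embIter_mem_of_blockOf_eq_endpoint' {M₁ : ℕ} (hM₁ : 1 ≤ M₁) {k : ℕ} (hkK : k + 1 ≤ P.m + P.K) {Ω : ℕ → Set (Site P 0)}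
    (hsepk : Sect2.enlT P (side P.L M₁ (k + 1)) 1 (Ω (k + 1)) ⊆ Ω k)
    {c : PBond P (k + 1)} (hc : c ∈ bondsOf (pts (k + 1) (Ω (k + 1)))) {y : Site P k} (hy : blockOf y = c.src ∨ blockOf y = c.tgt) :
    embIter k y ∈ Ω k := by
  have key : ∀ z₀ : Site P (k + 1), embIter (k + 1) z₀ ∈ Ω (k + 1) → distSite (Mk P (k + 1)) z₀ (blockOf y) ≤ 1 → embIter k y ∈ Ω k := by
    intro z₀ hz₀ hd
    apply hsepk
    have h1 : iterBlockOf (k + 1) (embIter (k + 1) z₀) = z₀ := by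
      rw [← blockIter_eq_iterBlockOf']; exact blockIter_embIter (k + 1) hkK z₀
    have h2 : iterBlockOf (k + 1) (embIter k y) = blockOf y := by
      rw [← blockIter_eq_iterBlockOf', B14.Eq22Determines.blockIter_succ, blockIter_embIter k (by omega) y]
    have h := mem_enlT_of_distSite_iterBlockOf_le_one (n := k + 1) hkK hM₁ (Y := Ω (k + 1)) (x := embIter (k + 1) z₀) (x' := embIter k y) hz₀
      (by rw [h1, h2]; exact hd)
    exact h
  rcases hc with hsrc | htgt
  · refine key c.src hsrc ?_
    rcases hy with h | h
    · rw [h, distSite_self]; norm_num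
    · rw [h]; exact distSite_shift_le_one c.src c.dir
  · refine key c.tgt htgt ?_
    rcases hy with h | h
    · rw [h, distSite_comm]; exact distSite_shift_le_one c.src c.dir
    · rw [h, distSite_self]; norm_num

end Geometry

/-! ## §2  The LIFT token's body at regular-realised data, `bd := lamDatum F` -/

section Lift

variable {F : T4Family} {N : ℕ} [NeZero N]

/-- ★★ **[15] (11)–(13) AT REGULAR-REALISED DATA, PRINT's DATUM, EVERY SEPARATED INDEX, ANY SELECTOR READ THROUGH `Ω_1`** (`VariationalThm1EULiftTop7MGB F N Sup Adm (lamDatum F)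
(dataRegularRealisedTopOf F N) C₁ …`'s conclusion): for an index `s` of length `k+1` with `0 < k`, `k+1 ≤ m+K`, separated with `1 ≤ ν.M₁`, thresholds `δ_n` in the numeric range, `0 ≤ B₃`,
`2·L³ ≤ C₁` and a regular-realised datum `W`, the witnesses `ε₀′ := ε₀`, `δ′ := δ`, `V₀ := W` (print's (11) with «V̄₀ = V» an identity) satisfy the numeric rows, the data row of the
TRUNCATED problem (heredity), and — for every (8)-regular minimiser `U` of the truncated problem constrained on `Λ(truncSeq s, k)` — (14) at length `k+1` over `Λ(s, k+1)`: regularity as in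
the flat certificate (ranges coincide below the top, sit inside the scale-`k` ranges at the top: factors `2L²` ∕ `2L³`), agreement below the top by `Λ_j ⊆ Λ′_j`, at the top by the
averaging's locality, §1 and (R).
[cite: Balaban1985Variational, (11) p.279, (12)–(14) p.280, Thm 1 p.279; Balaban1984PropagatorsII, (2.3) p.224; Balaban1985RegularSpaces, (1.3)–(1.9) p.77; Balaban1988Convergent, (2.1) p.254, (2.2) p.255, (2.10)–(2.12) p.256; Balaban1987RG1, (0.4) p.253] -/
theorem variationalThm1EULiftTop7MGB_body_of_realised
    (Sup : (ν : Stage7Numerics) → (K : ℕ) → (ℕ → Set (Site (F.P K) 0)) → Set (Site (F.P K) 0))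
    (ν : Stage7Numerics) (M : ℕ) (g : ℕ → ℝ) (K k : ℕ) (s : SeqOfRecord F ν M g K (k + 1))
    (hk0 : 0 < k) (hkK : k + 1 ≤ (F.P K).m + (F.P K).K) (hsep : Sect2.SeqSeparated ν.M₁ s) (hM : 0 < ν.M₁)
    (hSup : Sup ν K (truncSeq s).Ω = Sup ν K s.Ω)
    {ε₀ C₁ B₃ a₀ a₁ : ℝ} {δ : ℕ → ℝ}
    (hnum : ∀ n, n ≤ k + 1 → 0 < δ n ∧ δ n ≤ a₁ ∧ B₃ * δ n ≤ ε₀) (hc : ∀ n, n < k + 1 → δ n ≤ 2 * δ (n + 1))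
    (hc' : ∀ n, n < k + 1 → δ (n + 1) ≤ 2 * δ n) (hε : ε₀ ≤ a₀) (hB₃ : 0 ≤ B₃) (hC₁ : 2 * ((F.P K).L : ℝ) ^ 3 ≤ C₁)
    {W : MSField (F.P K) (SU N)} (hW : dataRegularRealisedTopOf F N K s.Ω (Sup ν K s.Ω) (k + 1) δ W) :
    ∃ (ε₀' : ℝ) (δ' : ℕ → ℝ) (V₀ : MSField (F.P K) (SU N)),
      (∀ n, n ≤ k → 0 < δ' n ∧ δ' n ≤ a₁ ∧ B₃ * δ' n ≤ ε₀') ∧ (∀ n, n < k → δ' n ≤ 2 * δ' (n + 1)) ∧ (∀ n, n < k → δ' (n + 1) ≤ 2 * δ' n) ∧ ε₀' ≤ a₀ ∧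
      dataRegularRealisedTopOf F N K (truncSeq s).Ω (Sup ν K (truncSeq s).Ω) k δ' V₀ ∧
      ∀ U : GaugeField (F.P K) 0 (SU N),
        IsMinimizerB (avOfRecord F N K)
            {U | (∀ n, n ≤ k → PlaqSmallOn (Sect2.omegaPlaqsTop (truncSeq s).Ω (Sup ν K (truncSeq s).Ω) n) (ε₀' * (F.P K).eta n ^ 2) U) ∧
              Sect2.CoDivClassOnTop (truncSeq s).Ω (Sup ν K (truncSeq s).Ω) k ε₀' U} (lamDatum F K k (truncSeq s).Ω) V₀ U →
        ((∀ n, n ≤ k → PlaqSmallOn (Sect2.omegaPlaqsTop (truncSeq s).Ω (Sup ν K (truncSeq s).Ω) n) (B₃ * δ' n * (F.P K).eta n ^ 2) U) ∧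
          ∀ n, n ≤ k → Sect2.CoDivSmallOn (Sect2.omegaBondsTop (truncSeq s).Ω (Sup ν K (truncSeq s).Ω) n) (B₃ * δ' n * (F.P K).eta n ^ 3) U) →
        ApproxMinTopB (avOfRecord F N K) s.Ω (Sup ν K s.Ω) (k + 1) (fun n => C₁ * B₃ * δ n) (lamDatum F K (k + 1) s.Ω) W U := by
  have hW' : DataRegularRealisedTop (avOfRecord F N K) s.Ω (Sup ν K s.Ω) (k + 1) δ W := hW
  refine ⟨ε₀, δ, W, fun n hn => hnum n (by omega), fun n hn => hc n (by omega), fun n hn => hc' n (by omega), hε, ?_, fun U hU h8 => ?_⟩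
  · -- the truncated problem's data row: heredity of regular-realised data (print's (11) «V₀ satisfies (7) on 𝔅′_{k−1}» with `V₀ := V`)
    show DataRegularRealisedTop (avOfRecord F N K) (truncSeq s).Ω (Sup ν K (truncSeq s).Ω) k δ W
    rw [hSup]
    exact hW'.truncSeq s hk0
  -- numerics
  have hL1 : (1 : ℝ) ≤ (F.P K).L := by exact_mod_cast (F.P K).L_pos
  have hL0 : (0 : ℝ) ≤ (F.P K).L := zero_le_one.trans hL1
  have hC3 : 2 * ((F.P K).L : ℝ) ^ 2 ≤ C₁ := le_trans (by nlinarith [pow_le_pow_right₀ hL1 (show 2 ≤ 3 by norm_num)]) hC₁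
  have hC1 : (1 : ℝ) ≤ C₁ := le_trans (by nlinarith [one_le_pow₀ (M₀ := ℝ) hL1 (n := 3)]) hC₁
  have hη : ∀ j, 0 ≤ (F.P K).eta j := fun j => (eta_pos (F.P K) j).le
  have hδ0 : ∀ n, n ≤ k + 1 → 0 ≤ δ n := fun n hn => (hnum n hn).1.le
  have hM₁ : 1 ≤ ν.M₁ := hM
  -- the class ranges at the scales `≤ k` coincide; the top ranges sit inside the scale-`k` ones (✓p767704 §4)
  have hΩP : ∀ n, n ≤ k → Sect2.omegaPlaqsTop s.Ω (Sup ν K s.Ω) n = Sect2.omegaPlaqsTop (truncSeq s).Ω (Sup ν K (truncSeq s).Ω) n := by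
    intro n hn; rw [hSup, omegaPlaqsTop_truncSeq_of_le s _ hn]
  have hΩB : ∀ n, n ≤ k → Sect2.omegaBondsTop s.Ω (Sup ν K s.Ω) n = Sect2.omegaBondsTop (truncSeq s).Ω (Sup ν K (truncSeq s).Ω) n := by
    intro n hn; rw [hSup, omegaBondsTop_truncSeq_of_le s _ hn]
  have hPtop : Sect2.omegaPlaqsTop s.Ω (Sup ν K s.Ω) (k + 1) ⊆ Sect2.omegaPlaqsTop (truncSeq s).Ω (Sup ν K (truncSeq s).Ω) k := by
    rw [hSup]; exact omegaPlaqsTop_succ_subset_truncSeq s hk0 _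
  have hBtop : Sect2.omegaBondsTop s.Ω (Sup ν K s.Ω) (k + 1) ⊆ Sect2.omegaBondsTop (truncSeq s).Ω (Sup ν K (truncSeq s).Ω) k := by
    rw [hSup]; exact omegaBondsTop_succ_subset_truncSeq s hk0 _
  -- thresholds: `B₃δ_n ≤ C₁B₃δ_n` below the top, and `B₃δ_k·η_k^p ≤ C₁B₃δ_{k+1}·η_{k+1}^p` (`p = 2, 3`) at the top
  have hmono : ∀ n, n ≤ k + 1 → ∀ (t : ℝ), 0 ≤ t → B₃ * δ n * t ≤ C₁ * B₃ * δ n * t := by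
    intro n hn t ht
    calc B₃ * δ n * t = 1 * (B₃ * δ n * t) := (one_mul _).symm
      _ ≤ C₁ * (B₃ * δ n * t) := mul_le_mul_of_nonneg_right hC1 (mul_nonneg (mul_nonneg hB₃ (hδ0 n hn)) ht)
      _ = C₁ * B₃ * δ n * t := by ring
  have hηk : (F.P K).eta k = ((F.P K).L : ℝ) * (F.P K).eta (k + 1) := eta_eq_L_mul_eta_succ (F.P K) k
  have hδk : δ k ≤ 2 * δ (k + 1) := hc k (lt_add_one k)
  have htop : ∀ (p : ℕ), 2 * ((F.P K).L : ℝ) ^ p ≤ C₁ →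
      B₃ * δ k * (F.P K).eta k ^ p ≤ C₁ * B₃ * δ (k + 1) * (F.P K).eta (k + 1) ^ p := by
    intro p hCp
    have hηp : 0 ≤ (F.P K).eta (k + 1) ^ p := pow_nonneg (hη (k + 1)) p
    calc B₃ * δ k * (F.P K).eta k ^ p = (B₃ * (F.P K).eta (k + 1) ^ p) * (δ k * ((F.P K).L : ℝ) ^ p) := by rw [hηk, mul_pow]; ring
      _ ≤ (B₃ * (F.P K).eta (k + 1) ^ p) * (2 * δ (k + 1) * ((F.P K).L : ℝ) ^ p) :=
          mul_le_mul_of_nonneg_left (mul_le_mul_of_nonneg_right hδk (pow_nonneg hL0 p)) (mul_nonneg hB₃ hηp)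
      _ = (2 * ((F.P K).L : ℝ) ^ p) * (B₃ * δ (k + 1) * (F.P K).eta (k + 1) ^ p) := by ring
      _ ≤ C₁ * (B₃ * δ (k + 1) * (F.P K).eta (k + 1) ^ p) := mul_le_mul_of_nonneg_right hCp (mul_nonneg (mul_nonneg hB₃ (hδ0 (k + 1) le_rfl)) hηp)
      _ = C₁ * B₃ * δ (k + 1) * (F.P K).eta (k + 1) ^ p := by ring
  refine ⟨fun n hn => ?_, fun n hn => ?_, fun j b hb => ?_⟩
  · -- (14), plaquettes
    rcases Nat.lt_or_ge n (k + 1) with hlt | hge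
    · have hn' : n ≤ k := by omega
      rw [hΩP n hn']
      exact fun p hp => (h8.1 n hn' p hp).trans_le (hmono n hn _ (pow_nonneg (hη n) 2))
    · obtain rfl : n = k + 1 := le_antisymm hn hge
      exact fun p hp => (h8.1 k le_rfl p (hPtop hp)).trans_le (htop 2 hC3)
  · -- (14), co-divergence
    rcases Nat.lt_or_ge n (k + 1) with hlt | hge
    · have hn' : n ≤ k := by omega
      rw [hΩB n hn']
      exact fun b hb => (h8.2 n hn' b hb).trans_le (hmono n hn _ (pow_nonneg (hη n) 3))
    · obtain rfl : n = k + 1 := le_antisymm hn hge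
      exact fun b hb => (h8.2 k le_rfl b (hBtop hb)).trans_le (htop 3 hC₁)
  · -- (14), agreement with `W` on `Λ(s, k+1)`
    change b ∈ lamBondsSeq s.Ω (k + 1) j at hb
    rcases Nat.lt_or_ge j (k + 1) with hlt | hge
    · -- below the top: `Λ_j ⊆ Λ′_j` (✓p767704), and `V₀ = W`
      exact agreeOnB_lamBondsSeq_below_of_truncSeq s hk0 hU.2.1 (by omega) hb
    · rcases Nat.eq_or_lt_of_le hge with heq | hgt
      swap
      · -- above the top there is no member
        exfalso
        rw [B15DeterminingSetsB.lamBondsSeq_of_gt s.Ω (k + 1) hgt] at hb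
        exact hb
      -- the top scale: locality of the averaging + §1 + (R) `W (k+1) = M(W k)`
      subst heq
      have hb' : b ∈ bondsOf (pts (k + 1) (s.Ω (k + 1))) := by rwa [lamBondsSeq_succ_top s] at hb
      show (avOfRecord F N K k).avg (Averaging.iter (avOfRecord F N K) k U) b = W (k + 1) b
      rw [hW'.real (lt_add_one k)]
      refine (avOfRecord F N K k).local_dep hkK _ _ b fun b' hb'src => ?_
      have hmem : embIter k b'.src ∈ s.Ω k := embIter_mem_of_blockOf_eq_endpoint' hM₁ hkK (hsep k hk0 (lt_add_one k)) hb' hb'src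
      have hb'' : b' ∈ lamBondsSeq (truncSeq s).Ω k k := by
        rw [lamBondsSeq_truncSeq_top s]
        exact Or.inl hmem
      exact hU.2.1 k b' hb''

/-! ## §3  The LIFT token over `(lamDatum F, dataRegularRealisedTopOf F N)` -/

/-- ★★ **THE LIFT TOKEN AT REGULAR-REALISED DATA, PRINT's DATUM, ANY SELECTOR INVARIANT UNDER TRUNCATION**, for every guard implying the standing range `k ≤ m + K`, `0 ≤ B₃`, `2L³ ≤ C₁`.
[cite: Balaban1985Variational, (11) p.279, (12)–(14) p.280; Balaban1984PropagatorsII, (2.3) p.224; Balaban1988Convergent, (2.18) p.257] -/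
theorem variationalThm1EULiftTop7MGB_realised
    (Sup : (ν : Stage7Numerics) → (K : ℕ) → (ℕ → Set (Site (F.P K) 0)) → Set (Site (F.P K) 0))
    (hSup : ∀ (ν : Stage7Numerics) (M : ℕ) (g : ℕ → ℝ) (K k : ℕ) (s : SeqOfRecord F ν M g K (k + 1)), 0 < k → Sup ν K (truncSeq s).Ω = Sup ν K s.Ω)
    (Adm : StepGuard F) (hAdmK : ∀ ν M g K k s, Adm ν M g K k s → k ≤ (F.P K).m + (F.P K).K)
    {C₁ B₃ a₀ a₁ : ℝ} (hB₃ : 0 ≤ B₃) (hC₁ : 2 * (F.L : ℝ) ^ 3 ≤ C₁) :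
    VariationalThm1EULiftTop7MGB F N Sup Adm (lamDatum F) (dataRegularRealisedTopOf F N) C₁ B₃ a₀ a₁ := by
  intro ν M g K k s hk0 hsep hM hadm ε₀ δ hnum hc hc' hε W hW
  exact variationalThm1EULiftTop7MGB_body_of_realised Sup ν M g K k s hk0 (hAdmK ν M g K (k + 1) s hadm) hsep hM (hSup ν M g K k s hk0)
    hnum hc hc' hε hB₃ hC₁ hW

/-- ★★ **`CoP` EDITION — THE LIFT TOKEN AT REGULAR-REALISED DATA ON THE SUPPORT OF RECORD, PRINT's DATUM** (node00-def-R's selector reads `Ω_1`, kept by the truncation), every guard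
implying the standing range. [cite: Balaban1985Variational, (11) p.279, (12)–(14) p.280; Balaban1984PropagatorsII, (2.3) p.224; Balaban1988Convergent, p.255, (2.12) p.256] -/
theorem variationalThm1EULiftCoP7MGB_realised (Adm : StepGuard F) (hAdmK : ∀ ν M g K k s, Adm ν M g K k s → k ≤ (F.P K).m + (F.P K).K)
    {C₁ B₃ a₀ a₁ : ℝ} (hB₃ : 0 ≤ B₃) (hC₁ : 2 * (F.L : ℝ) ^ 3 ≤ C₁) :
    VariationalThm1EULiftCoP7MGB F N Adm (lamDatum F) (dataRegularRealisedTopOf F N) C₁ B₃ a₀ a₁ :=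
  variationalThm1EULiftTop7MGB_realised (fun ν K Ω => suppDomOfRecord F ν K Ω) (fun _ν _M _g _K _k s hk => suppDomOfRecord_truncSeq s hk) Adm hAdmK hB₃ hC₁

end Lift

/-! ## §4  Print's induction at regular-realised data: (E∕U)ᴮ ⟸ STEPᴮ ∧ (R)ᴮ -/

section Induction

variable {F : T4Family} {N : ℕ} [NeZero N]

/-- ★★★ **[15] THEOREM 1 (E∕U) AT REGULAR-REALISED DATA, PRINT's [II] (2.3) DATUM, FROM THE ONE-LENGTH STEP TOKEN AND K0's (R)-NAME ALONE**: for every guard `Adm` implying the standing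
range and stable under print's truncation, and constants `0 ≤ B₃`, `2L³ ≤ C₁`, `8L³ < C₁B₃`, the step token `VariationalThm1EUStepCoP7MGB F N Adm (lamDatum F) (dataRegularRealisedTopOf F
N) C₁ B₃ a₀ a₁` ([15] Prop. 2 + Sects. B–E given `U₀` with (14)) and the (R)-name `Node00.VariationalThm1RegSepCoP7MGB F N Adm (lamDatum F) (dataRegularRealisedTopOf F N) B₃ a₀ a₁` give the
(E∕U)-name `VariationalThm1EUSepCoP7MGB F N Adm (lamDatum F) (dataRegularRealisedTopOf F N) B₃ a₀ a₁` — dag-n12-c g34's induction with SUPPLY-at-1 (`approxMinimiserExistsCoP7MGB_lengthOne_realised`)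
and LIFT (§3) DISCHARGED. [cite: Balaban1985Variational, Thm 1 p.279, (11) p.279, (12)–(14) p.280, Prop. 2 p.281; Balaban1984PropagatorsII, (2.3) p.224; Balaban1988Convergent, (2.12) p.256, (2.18) p.257] -/
theorem variationalThm1EUSepCoP7MGB_realised_of_step_of_reg (Adm : StepGuard F)
    (hAdmK : ∀ ν M g K k s, Adm ν M g K k s → k ≤ (F.P K).m + (F.P K).K)
    (hAdmTr : ∀ ν M g K k (s : SeqOfRecord F ν M g K (k + 1)), 0 < k → Adm ν M g K (k + 1) s → Adm ν M g K k (truncSeq s))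
    {C₁ B₃ a₀ a₁ : ℝ} (hB₃ : 0 ≤ B₃) (hC₁ : 2 * (F.L : ℝ) ^ 3 ≤ C₁) (hCB : 8 * (F.L : ℝ) ^ 3 < C₁ * B₃)
    (hstep : VariationalThm1EUStepCoP7MGB F N Adm (lamDatum F) (dataRegularRealisedTopOf F N) C₁ B₃ a₀ a₁)
    (hR : VariationalThm1RegSepCoP7MGB F N Adm (lamDatum F) (dataRegularRealisedTopOf F N) B₃ a₀ a₁) :
    VariationalThm1EUSepCoP7MGB F N Adm (lamDatum F) (dataRegularRealisedTopOf F N) B₃ a₀ a₁ :=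
  variationalThm1EUSepCoP7MGB_of_step_of_reg_of_base_of_lift hstep hR (approxMinimiserExistsCoP7MGB_lengthOne_realised Adm hCB)
    (variationalThm1EULiftCoP7MGB_realised Adm hAdmK hB₃ hC₁) hAdmTr

/-- ★★★ **THE SAME WITH THE STEP TOKEN AND THE (R)-NAME READ AT PRINT's (α) DATA PREDICATE `dataSmall7LamTopOf`** (weaker data hypothesis ⇒ both serve regular-realised data by
`.of_imp_dat`): at print's datum and regular-realised data the (E∕U)-name follows from `VariationalThm1EUStepCoP7MGB F N Adm (lamDatum F) (dataSmall7LamTopOf F N) C₁ B₃ a₀ a₁` and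
`Node00.VariationalThm1RegSepCoP7MGB F N Adm (lamDatum F) (dataSmall7LamTopOf F N) B₃ a₀ a₁`. [cite: Balaban1985Variational, Thm 1 p.279, (7) p.278, Prop. 2 p.281; Balaban1984PropagatorsII, (2.3) p.224] -/
theorem variationalThm1EUSepCoP7MGB_realised_of_step_of_reg_lamTop (Adm : StepGuard F)
    (hAdmK : ∀ ν M g K k s, Adm ν M g K k s → k ≤ (F.P K).m + (F.P K).K)
    (hAdmTr : ∀ ν M g K k (s : SeqOfRecord F ν M g K (k + 1)), 0 < k → Adm ν M g K (k + 1) s → Adm ν M g K k (truncSeq s))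
    {C₁ B₃ a₀ a₁ : ℝ} (hB₃ : 0 ≤ B₃) (hC₁ : 2 * (F.L : ℝ) ^ 3 ≤ C₁) (hCB : 8 * (F.L : ℝ) ^ 3 < C₁ * B₃)
    (hstep : VariationalThm1EUStepCoP7MGB F N Adm (lamDatum F) (dataSmall7LamTopOf F N) C₁ B₃ a₀ a₁)
    (hR : VariationalThm1RegSepCoP7MGB F N Adm (lamDatum F) (dataSmall7LamTopOf F N) B₃ a₀ a₁) :
    VariationalThm1EUSepCoP7MGB F N Adm (lamDatum F) (dataRegularRealisedTopOf F N) B₃ a₀ a₁ :=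
  variationalThm1EUSepCoP7MGB_realised_of_step_of_reg Adm hAdmK hAdmTr hB₃ hC₁ hCB
    (hstep.of_imp_dat (dataSmall7LamTopOf_of_dataRegularRealisedTopOf (F := F) (N := N)))
    (hR.of_imp_dat (dataSmall7LamTopOf_of_dataRegularRealisedTopOf (F := F) (N := N)))

/-- ★★★ **THE SAME WITH THE STEP TOKEN AND THE (R)-NAME READ AT THE RECORD's (b) DATA PREDICATE `dataSmall7PTopOf`** (the currency of the junction of record v14ᴸᴮ's two [15] names).
[cite: Balaban1985Variational, Thm 1 p.279, (7) p.278, Prop. 2 p.281; Balaban1988Convergent, (2.10)–(2.12) p.256] -/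
theorem variationalThm1EUSepCoP7MGB_realised_of_step_of_reg_pTop (Adm : StepGuard F)
    (hAdmK : ∀ ν M g K k s, Adm ν M g K k s → k ≤ (F.P K).m + (F.P K).K)
    (hAdmTr : ∀ ν M g K k (s : SeqOfRecord F ν M g K (k + 1)), 0 < k → Adm ν M g K (k + 1) s → Adm ν M g K k (truncSeq s))
    {C₁ B₃ a₀ a₁ : ℝ} (hB₃ : 0 ≤ B₃) (hC₁ : 2 * (F.L : ℝ) ^ 3 ≤ C₁) (hCB : 8 * (F.L : ℝ) ^ 3 < C₁ * B₃)
    (hstep : VariationalThm1EUStepCoP7MGB F N Adm (lamDatum F) (dataSmall7PTopOf F N) C₁ B₃ a₀ a₁)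
    (hR : VariationalThm1RegSepCoP7MGB F N Adm (lamDatum F) (dataSmall7PTopOf F N) B₃ a₀ a₁) :
    VariationalThm1EUSepCoP7MGB F N Adm (lamDatum F) (dataRegularRealisedTopOf F N) B₃ a₀ a₁ :=
  variationalThm1EUSepCoP7MGB_realised_of_step_of_reg Adm hAdmK hAdmTr hB₃ hC₁ hCB
    (hstep.of_imp_dat (dataSmall7PTopOf_of_dataRegularRealisedTopOf (F := F) (N := N)))
    (hR.of_imp_dat (dataSmall7PTopOf_of_dataRegularRealisedTopOf (F := F) (N := N)))

end Induction

end Summit.QuantumFields.YangMills.BalabanUVNodes.N12EUStepTokensAtRealisedDataLam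

end
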